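import Mathlib
import Summits.ValiantsHypothesis.ValiantsHypothesis.Theorems.NNDivisionHard.Negative.LocatedPencilLawFalsePassenger
import Summits.ValiantsHypothesis.ValiantsHypothesis.Theorems.NNDivisionHard.Negative.LocatedPencilLawFalseSlots
import Summits.ValiantsHypothesis.ValiantsHypothesis.Theorems.NNDivisionHard.Negative.LocatedPencilLawFalseVertex

/-!
# KILL NOTE N22, kernel part 4a — the layer cake (crux `FifoMatching.NNDivisionHard`,
# stmt-ValiantsHypothesis-21181; Negative lane)
val-idea-crit-9 g2 (critic of record, WAVE 6).  For every row `a` and every REAL diagonal tilt `v − 𝟙_a` the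
diagonal part of the augmented slack against the columns `(b, π)` of `COR(n) + Q^Π_λ`,
`G(a,v; b,π) = (1 − |a∩b|)² + Σ_i (max(v_i − 𝟙_a(i), 0) − (v_i − 𝟙_a(i)) b_i) + λ (pval v π − pmin v)`,
is a nonnegative combination of the poly(n) column functions of `…Slots` plus three ray families
(`1 − b_i`, `b_i`, `[π j < π i]`) — `rep_Gfun`.  Proof: induction on the number of values of `v` outside `{0,1}`;
a plateau is peeled up / down along a ray, or interpolated between its two neighbours inside `[0,1]`, always with a
COMMON antivarying permutation so that `pmin` is affine along the move; the base `v = 𝟙_c` is `vertex_identity`.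
Theorems only; VP ≠ VNP is NOT proved; the crux stays OPEN.
-/

namespace Summit.ValiantsHypothesis.Theorems.NNDivisionHardNegative.LocatedPencil

open Matrix Finset
open Summit.ValiantsHypothesis.ValiantsHypothesis.Theorems.FifoMatching.XcDivision (udInd udInd_apply udInd_sq udInd_inter)
open Summit.ValiantsHypothesis.Theorems.NNDivisionHardNegative.DiagTilted (udInd_compl udInd_nonneg' udInd_le_one')

noncomputable section

variable {n : ℕ}

/-! ## §1 The representable cone -/

/-- slots of the diagonal layer: the vertex slots plus the three ray families. -/
abbrev DSlot (n : ℕ) := Slot n ⊕ Fin n ⊕ Fin n ⊕ (Fin n × Fin n)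

/-- column functions on `DSlot`: `colV`, `1 − b_i`, `b_i`, `[π j < π i]`. -/
def dcolV (b : Finset (Fin n)) (π : Equiv.Perm (Fin n)) : DSlot n → ℝ :=
  Sum.elim (colV b π) (Sum.elim (fun i => 1 - udInd b i)
    (Sum.elim (fun i => udInd b i) (fun p => if π p.2 < π p.1 then 1 else 0)))

/-- `dcolV ≥ 0`. -/
theorem dcolV_nonneg (hn : 1 ≤ n) (b : Finset (Fin n)) (π : Equiv.Perm (Fin n)) (s : DSlot n) :
    0 ≤ dcolV b π s := by
  rcases s with s | s | s | p
  · exact colV_nonneg hn b π s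
  · exact sub_nonneg.mpr (udInd_le_one' b s)
  · exact udInd_nonneg' b s
  · simp only [dcolV, Sum.elim_inr]; split_ifs <;> norm_num

/-- assembling a coefficient vector from its four blocks. -/
def mkU (u₀ : Slot n → ℝ) (u₁ u₂ : Fin n → ℝ) (u₃ : Fin n × Fin n → ℝ) : DSlot n → ℝ :=
  Sum.elim u₀ (Sum.elim u₁ (Sum.elim u₂ u₃))

/-- the pairing of `mkU` with `dcolV`, block by block. -/
theorem sum_mkU (u₀ : Slot n → ℝ) (u₁ u₂ : Fin n → ℝ) (u₃ : Fin n × Fin n → ℝ)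
    (b : Finset (Fin n)) (π : Equiv.Perm (Fin n)) :
    ∑ s, mkU u₀ u₁ u₂ u₃ s * dcolV b π s
      = ∑ s, u₀ s * colV b π s + ∑ i, u₁ i * (1 - udInd b i) + ∑ i, u₂ i * udInd b i
        + ∑ p : Fin n × Fin n, u₃ p * (if π p.2 < π p.1 then 1 else 0) := by
  simp only [Fintype.sum_sum_type, mkU, dcolV, Sum.elim_inl, Sum.elim_inr]
  ring

/-- `f` is a nonnegative combination of the column functions `dcolV`. -/
def Rep (f : Finset (Fin n) → Equiv.Perm (Fin n) → ℝ) : Prop :=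
  ∃ u : DSlot n → ℝ, (∀ s, 0 ≤ u s) ∧ ∀ b π, f b π = ∑ s, u s * dcolV b π s

/-- the cone is closed under sums. -/
theorem Rep.add {f g : Finset (Fin n) → Equiv.Perm (Fin n) → ℝ} (hf : Rep f) (hg : Rep g) :
    Rep (fun b π => f b π + g b π) := by
  obtain ⟨u, hu, hf⟩ := hf
  obtain ⟨w, hw, hg⟩ := hg
  refine ⟨fun s => u s + w s, fun s => add_nonneg (hu s) (hw s), fun b π => ?_⟩
  show f b π + g b π = _
  rw [hf, hg, ← Finset.sum_add_distrib]
  exact Finset.sum_congr rfl fun s _ => by ring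

/-- the cone is closed under nonnegative scaling. -/
theorem Rep.smul {f : Finset (Fin n) → Equiv.Perm (Fin n) → ℝ} (hf : Rep f) {t : ℝ} (ht : 0 ≤ t) :
    Rep (fun b π => t * f b π) := by
  obtain ⟨u, hu, hf⟩ := hf
  refine ⟨fun s => t * u s, fun s => mul_nonneg ht (hu s), fun b π => ?_⟩
  show t * f b π = _
  rw [hf, Finset.mul_sum]
  exact Finset.sum_congr rfl fun s _ => by ring

/-- the cone is extensional. -/
theorem Rep.congr {f g : Finset (Fin n) → Equiv.Perm (Fin n) → ℝ} (hf : Rep f) (h : ∀ b π, g b π = f b π) :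
    Rep g := by
  obtain ⟨u, hu, hf⟩ := hf
  exact ⟨u, hu, fun b π => (h b π).trans (hf b π)⟩

/-- the vertex rows are in the cone (`vertex_identity`'s right-hand side). -/
theorem rep_base (a c : Finset (Fin n)) : Rep (fun b π => ∑ s, rowU a c s * colV b π s) := by
  refine ⟨mkU (rowU a c) 0 0 0, ?_, fun b π => ?_⟩
  · rintro (s | s | s | p)
    · exact rowU_nonneg a c s
    all_goals exact le_rfl
  · rw [sum_mkU]; simp

/-- the ray `Σ_{i∈C} (1 − b_i)` is in the cone. -/
theorem rep_raySub (C : Finset (Fin n)) : Rep (fun b _ => ∑ i ∈ C, (1 - udInd b i)) := by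
  refine ⟨mkU 0 (udInd C) 0 0, ?_, fun b π => ?_⟩
  · rintro (s | s | s | p)
    · exact le_rfl
    · exact udInd_nonneg' C s
    all_goals exact le_rfl
  · show ∑ i ∈ C, (1 - udInd b i) = _
    rw [sum_mkU, sum_mem_udInd C (fun i => 1 - udInd b i)]
    simp only [Pi.zero_apply, zero_mul, Finset.sum_const_zero, zero_add, add_zero]

/-- the ray `Σ_{i∈C} b_i` is in the cone. -/
theorem rep_rayInd (C : Finset (Fin n)) : Rep (fun b _ => ∑ i ∈ C, udInd b i) := by
  refine ⟨mkU 0 0 (udInd C) 0, ?_, fun b π => ?_⟩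
  · rintro (s | s | s | p)
    · exact le_rfl
    · exact le_rfl
    · exact udInd_nonneg' C s
    · exact le_rfl
  · show ∑ i ∈ C, udInd b i = _
    rw [sum_mkU, sum_mem_udInd C (fun i => udInd b i)]
    simp only [Pi.zero_apply, zero_mul, Finset.sum_const_zero, zero_add, add_zero]

/-- the ray `inv(C; π)` is in the cone. -/
theorem rep_inv (C : Finset (Fin n)) : Rep (fun _ π => inv C π) := by
  refine ⟨mkU 0 0 0 (fun p => udInd C p.1 * (1 - udInd C p.2)), ?_, fun b π => ?_⟩
  · rintro (s | s | s | p)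
    · exact le_rfl
    · exact le_rfl
    · exact le_rfl
    · exact mul_nonneg (udInd_nonneg' C p.1) (sub_nonneg.mpr (udInd_le_one' C p.2))
  · show inv C π = _
    rw [sum_mkU, inv_eq_sum, ← Fintype.sum_prod_type']
    simp only [Pi.zero_apply, zero_mul, Finset.sum_const_zero, zero_add]

/-! ## §2 The diagonal slack function and the plateau calculus -/

/-- the diagonal part of the augmented slack of the tilted row `(a, v − 𝟙_a)` against the column `(b, π)`. -/
def Gfun (a : Finset (Fin n)) (v : Fin n → ℝ) (b : Finset (Fin n)) (π : Equiv.Perm (Fin n)) : ℝ :=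
  (1 - ((a ∩ b).card : ℝ)) ^ 2 + ∑ i, (max (v i - udInd a i) 0 - (v i - udInd a i) * udInd b i)
    + lam n * (pval v π - pmin v)

/-- overwrite `v` on `C` by the constant `t`. -/
def setOn (v : Fin n → ℝ) (C : Finset (Fin n)) (t : ℝ) : Fin n → ℝ := fun i => if i ∈ C then t else v i

/-- the plateau of the value `h`. -/
def plateau (v : Fin n → ℝ) (h : ℝ) : Finset (Fin n) := Finset.univ.filter fun i => v i = h

/-- membership in a plateau. -/
theorem mem_plateau {v : Fin n → ℝ} {h : ℝ} {i : Fin n} : i ∈ plateau v h ↔ v i = h := by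
  simp [plateau]

/-- overwriting a plateau by its own value does nothing. -/
theorem setOn_plateau (v : Fin n → ℝ) (h : ℝ) : setOn v (plateau v h) h = v := by
  funext i; unfold setOn
  split_ifs with hi
  · exact (mem_plateau.1 hi).symm
  · rfl

/-- `pval` is affine along a plateau move. -/
theorem pval_setOn_sub (v : Fin n → ℝ) (C : Finset (Fin n)) (s t : ℝ) (π : Equiv.Perm (Fin n)) :
    pval (setOn v C t) π - pval (setOn v C s) π = (t - s) * pval (udInd C) π := by
  unfold pval
  rw [← Finset.sum_sub_distrib, Finset.mul_sum]
  refine Finset.sum_congr rfl fun i _ => ?_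
  unfold setOn; rw [udInd_apply]; split_ifs <;> ring

/-- **core difference**: along a plateau move with a common antivarying permutation and no sign change of the
tilt, `G` changes by `(t − s)·(ray + λ (pval 𝟙_C π − pval 𝟙_C π₀))`. -/
theorem core_diff (a : Finset (Fin n)) (v : Fin n → ℝ) (C Cup : Finset (Fin n)) (s t : ℝ)
    (π₀ : Equiv.Perm (Fin n)) (hs : Antivary (setOn v C s) (rk π₀)) (ht : Antivary (setOn v C t) (rk π₀))
    (hbr : ∀ i ∈ C, (i ∈ Cup → udInd a i ≤ s ∧ udInd a i ≤ t) ∧ (i ∉ Cup → s ≤ udInd a i ∧ t ≤ udInd a i))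
    (b : Finset (Fin n)) (π : Equiv.Perm (Fin n)) :
    Gfun a (setOn v C t) b π - Gfun a (setOn v C s) b π
      = (t - s) * ((∑ i ∈ C, if i ∈ Cup then 1 - udInd b i else -udInd b i)
          + lam n * (pval (udInd C) π - pval (udInd C) π₀)) := by
  have hφ : ∀ i, (max (setOn v C t i - udInd a i) 0 - (setOn v C t i - udInd a i) * udInd b i)
      - (max (setOn v C s i - udInd a i) 0 - (setOn v C s i - udInd a i) * udInd b i)
      = (t - s) * (if i ∈ C then (if i ∈ Cup then 1 - udInd b i else -udInd b i) else 0) := by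
    intro i
    unfold setOn
    by_cases hC : i ∈ C
    · simp only [if_pos hC]
      by_cases hU : i ∈ Cup
      · obtain ⟨h1, h2⟩ := (hbr i hC).1 hU
        rw [if_pos hU, max_eq_left (by linarith), max_eq_left (by linarith)]; ring
      · obtain ⟨h1, h2⟩ := (hbr i hC).2 hU
        rw [if_neg hU, max_eq_right (by linarith), max_eq_right (by linarith)]; ring
    · simp only [if_neg hC]; ring
  have hsum : ∑ i, (max (setOn v C t i - udInd a i) 0 - (setOn v C t i - udInd a i) * udInd b i)
      - ∑ i, (max (setOn v C s i - udInd a i) 0 - (setOn v C s i - udInd a i) * udInd b i)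
      = (t - s) * ∑ i ∈ C, (if i ∈ Cup then 1 - udInd b i else -udInd b i) := by
    rw [← Finset.sum_sub_distrib]
    simp only [hφ]
    rw [← Finset.mul_sum, Finset.sum_ite_mem, Finset.univ_inter]
  have h1 := pval_setOn_sub v C s t π
  have h2 := pval_setOn_sub v C s t π₀
  unfold Gfun
  rw [pmin_eq_of_antivary ht, pmin_eq_of_antivary hs]
  linear_combination hsum + lam n * h1 - lam n * h2

/-- a plateau move that stays between the neighbouring values is weakly order preserving. -/
theorem setOn_mono (v : Fin n → ℝ) (h₁ t : ℝ) (hlo : ∀ j, v j < h₁ → v j ≤ t) (hhi : ∀ j, h₁ < v j → t ≤ v j) :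
    ∀ i j, v j ≤ v i → setOn v (plateau v h₁) t j ≤ setOn v (plateau v h₁) t i := by
  intro i j hij
  unfold setOn
  by_cases hi : i ∈ plateau v h₁ <;> by_cases hj : j ∈ plateau v h₁
  · rw [if_pos hi, if_pos hj]
  · rw [if_pos hi, if_neg hj]
    rw [mem_plateau] at hi hj
    exact hlo j (lt_of_le_of_ne (hi ▸ hij) hj)
  · rw [if_neg hi, if_pos hj]
    rw [mem_plateau] at hi hj
    exact hhi i (lt_of_le_of_ne (hj ▸ hij) (Ne.symm hi))
  · rw [if_neg hi, if_neg hj]; exact hij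

/-- the indicator of a TOP plateau is ordered like `v`. -/
theorem udInd_plateau_max_mono (v : Fin n → ℝ) (h₁ : ℝ) (hmax : ∀ j, v j ≤ h₁) :
    ∀ i j, v j ≤ v i → udInd (plateau v h₁) j ≤ udInd (plateau v h₁) i := by
  intro i j hij
  by_cases hj : v j = h₁
  · have hi : v i = h₁ := le_antisymm (hmax i) (hj ▸ hij)
    rw [udInd_apply, udInd_apply, if_pos (mem_plateau.2 hj), if_pos (mem_plateau.2 hi)]
  · rw [udInd_apply (plateau v h₁) j, if_neg (fun h => hj (mem_plateau.1 h))]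
    exact udInd_nonneg' _ i

/-- the indicator of the complement of a BOTTOM plateau is ordered like `v`. -/
theorem udInd_plateau_min_compl_mono (v : Fin n → ℝ) (ℓ₁ : ℝ) (hmin : ∀ j, ℓ₁ ≤ v j) :
    ∀ i j, v j ≤ v i → udInd (plateau v ℓ₁)ᶜ j ≤ udInd (plateau v ℓ₁)ᶜ i := by
  intro i j hij
  by_cases hi : v i = ℓ₁
  · have hj : v j = ℓ₁ := le_antisymm (hi ▸ hij) (hmin j)
    rw [udInd_apply (plateau v ℓ₁)ᶜ j, if_neg (fun h => (Finset.mem_compl.1 h) (mem_plateau.2 hj))]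
    exact udInd_nonneg' _ i
  · rw [udInd_apply (plateau v ℓ₁)ᶜ i, if_pos (Finset.mem_compl.2 fun h => hi (mem_plateau.1 h))]
    exact udInd_le_one' _ j

/-- `Σ_i rk π i` does not depend on `π`. -/
theorem sum_rk (π : Equiv.Perm (Fin n)) : ∑ i, rk π i = ∑ i : Fin n, ((i : ℕ) : ℝ) := by
  unfold rk
  exact Equiv.sum_comp π (fun i : Fin n => ((i : ℕ) : ℝ))

/-- `pval 𝟙_{Cᶜ} = Σ rk − pval 𝟙_C`. -/
theorem pval_compl (C : Finset (Fin n)) (π : Equiv.Perm (Fin n)) :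
    pval (udInd Cᶜ) π = (∑ i : Fin n, ((i : ℕ) : ℝ)) - pval (udInd C) π := by
  rw [← sum_rk π]
  unfold pval
  rw [← Finset.sum_sub_distrib]
  refine Finset.sum_congr rfl fun i _ => ?_
  rw [udInd_compl]; ring

/-! ## §3 The measure of a tilt and its decrease -/

/-- the number of values of `v` outside `{0, 1}`. -/
def Nv (v : Fin n → ℝ) : ℕ := ((Finset.univ.image v).filter fun x => x ≠ 0 ∧ x ≠ 1).card

/-- replacing the plateau of a value `h₁ ∉ {0,1}` by `0`, `1` or another value of `v` decreases `Nv`. -/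
theorem Nv_setOn_lt (v : Fin n → ℝ) (h₁ t : ℝ) (hex : ∃ i, v i = h₁) (h0 : h₁ ≠ 0) (h1 : h₁ ≠ 1)
    (ht : t = 0 ∨ t = 1 ∨ ∃ j, v j = t ∧ t ≠ h₁) :
    Nv (setOn v (plateau v h₁) t) < Nv v := by
  unfold Nv
  apply Finset.card_lt_card
  have hsub : ((Finset.univ.image (setOn v (plateau v h₁) t)).filter fun x => x ≠ 0 ∧ x ≠ 1)
      ⊆ ((Finset.univ.image v).filter fun x => x ≠ 0 ∧ x ≠ 1) := by
    intro x hx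
    simp only [Finset.mem_filter, Finset.mem_image, Finset.mem_univ, true_and] at hx ⊢
    obtain ⟨⟨i, hi⟩, hx0, hx1⟩ := hx
    refine ⟨?_, hx0, hx1⟩
    unfold setOn at hi
    split_ifs at hi with hiC
    · subst hi
      rcases ht with h | h | ⟨j, hj, _⟩
      · exact absurd h hx0
      · exact absurd h hx1
      · exact ⟨j, hj⟩
    · exact ⟨i, hi⟩
  rw [Finset.ssubset_iff_of_subset hsub]
  obtain ⟨i₀, hi₀⟩ := hex
  refine ⟨h₁, ?_, ?_⟩
  · simp only [Finset.mem_filter, Finset.mem_image, Finset.mem_univ, true_and]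
    exact ⟨⟨i₀, hi₀⟩, h0, h1⟩
  · simp only [Finset.mem_filter, Finset.mem_image, Finset.mem_univ, true_and, not_and, not_not]
    intro ⟨i, hi⟩
    exfalso
    unfold setOn at hi
    split_ifs at hi with hiC
    · rcases ht with h | h | ⟨j, _, hj⟩
      · exact h0 (hi ▸ h ▸ rfl)
      · exact h1 (hi ▸ h ▸ rfl)
      · exact hj hi
    · exact hiC (mem_plateau.2 hi)

end

end Summit.ValiantsHypothesis.Theorems.NNDivisionHardNegative.LocatedPencil
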